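import Mathlib
import Literature.NumberTheory.LFunctions.WeilWindowSimpleEven
import Literature.NumberTheory.LFunctions.WeilExplicitProofs

/-!
# Sign-cone duality (stmt-RiemannHypothesis-16304), line Sketch — stub `stub_farNode`

Far nodes are invisible at cutoff `a`: the autocorrelation `G = g ⋆ g̃` of a Weil test function `g`
with `tsupport g ⊆ [-a, a]` vanishes at every `t ≥ 2a`, boundary `t = 2a` included. Indeed
`G(t) = ∫ g(u) conj (g (u - t)) du` (`weilConv_apply`, `weilReflect`), and the integrand is identically
zero: if `g u ≠ 0` then `u ∈ (-a, a)` (OPEN interval — `g` is continuous, so its support is open and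
sits inside `interior [-a, a]`), whence `u - t < a - 2a = -a` and `g (u - t) = 0`.

Support file for the crux skeleton `SignConeDuality` (only the nodes `log n < 2a` are active constraints).
-/

noncomputable section

-- `Summit.RiemannHypothesis.RiemannHypothesis.…` repeats a namespace component by design (D-0017 layout).
set_option linter.dupNamespace false

open scoped BigOperators ComplexConjugate
open Complex MeasureTheory Set

namespace Summit.RiemannHypothesis.RiemannHypothesis.Theorems.SignConeDuality

open Literature.NumberTheory.LFunctions

-- adapted from Cruxes/SignConeDuality/SketchIdeator1.lean (`mem_Ioo_of_apply_ne_zero`)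
/-- A continuous function whose topological support lies in `[-a, a]` vanishes off the open
interval `(-a, a)`: its support is open, hence contained in `interior [-a, a] = (-a, a)`. -/
theorem farNode_mem_Ioo_of_apply_ne_zero {a : ℝ} {g : ℝ → ℂ} (hg : Continuous g)
    (hsupp : tsupport g ⊆ Icc (-a) a) {s : ℝ} (hs : g s ≠ 0) : s ∈ Ioo (-a) a := by
  have h1 : Function.support g ⊆ interior (Icc (-a) a) :=
    interior_maximal ((subset_tsupport g).trans hsupp) hg.isOpen_support
  rw [interior_Icc] at h1
  exact h1 (Function.mem_support.2 hs)

-- adapted from Cruxes/SignConeDuality/SketchIdeator1.lean (`autocorr_eq_zero_of_two_mul_le`)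
/-- **Far nodes are invisible at cutoff `a`.** For a Weil test function `g` with
`tsupport g ⊆ [-a, a]`, the autocorrelation `g ⋆ g̃` vanishes at every `t ≥ 2a` (boundary included):
the integrand `g u * conj (g (u - t))` of `weilConv_apply` is identically zero, since `g u ≠ 0` forces
`u ∈ (-a, a)` and then `u - t < -a`. -/
theorem stub_farNode : ∀ (a : ℝ) (g : ℝ → ℂ), IsWeilTest g → tsupport g ⊆ Set.Icc (-a) a →
    ∀ t : ℝ, 2 * a ≤ t → weilConv g (weilReflect g) t = 0 := by
  intro a g hg hsupp t ht
  have hzero : (fun u : ℝ => g u * weilReflect g (t - u)) = fun _ => 0 := by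
    funext s
    simp only [weilReflect, neg_sub]
    by_cases hs : g s = 0
    · simp [hs]
    · have hs' := farNode_mem_Ioo_of_apply_ne_zero hg.1.continuous hsupp hs
      have hst : g (s - t) = 0 := by
        by_contra h
        have h' := farNode_mem_Ioo_of_apply_ne_zero hg.1.continuous hsupp h
        linarith [hs'.2, h'.1]
      simp [hst]
  rw [weilConv_apply, hzero, integral_zero]

end Summit.RiemannHypothesis.RiemannHypothesis.Theorems.SignConeDuality

end
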